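import Summits.FinalStateConjecture.FinalStateConjecture.Theorems.PhotonSphereChannelsEnergyIdentity

/-!
# Crux `UniformPhotonSphereChannels` (K1), negative side — energy identity with DEFECT SOURCE,
# time-dependent potential and a spatial weight

Support file of the standing disprover of item stmt-FinalStateConjecture-10045 (route
`PhotonSphereChannels`).  The Lean refutation of K1 (Rindler-frame energy method, see the crux
work file `Cruxes/UniformPhotonSphereChannels/Disproof.lean`) needs the energy–flux calculus of
`PhotonSphereChannelsEnergyIdentity` in three more general situations at once:

* the "potential" `W : ℝ × ℝ → ℝ` may depend on time (the Regge–Wheeler potential read in the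
  near-horizon Minkowski frame is a function of `X² − T²`);
* `u` need NOT solve any equation: the **defect** `F := u_tt − u_xx + W u` enters as a source
  (this covers the commuted field `∂ₓu`, which solves an inhomogeneous equation, and cut-off
  kernel elements, which solve the equation only on part of the plane);
* a `C¹` spatial weight `χ(x)` multiplies the energy density (momentum pinning of rest packets).

Pointwise law: `∂ₜ(χ e) − ∂ₓ(χ m) = χ (2 u_t F + (∂ₜW) u²) − χ' m` (`e = u_t² + u_x² + W u²`,
`m = 2 u_t u_x`); main result `weightedEnergy_identity_affine` (Green's formula on a box, exactly
as in the parent file), its unweighted form, and the local future domain of dependence for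
functions solving the equation only on the characteristic trapezoid.  Standard material [folklore].
-/

namespace Summit.FinalStateConjecture.FinalStateConjecture.Theorems

open MeasureTheory Set Filter Topology intervalIntegral

noncomputable section

namespace WaveDefect

open WaveEnergy

variable {u W : ℝ × ℝ → ℝ}

/-! ### Densities with a time-dependent potential -/

/-- The energy density `e = u_t² + u_x² + W u²` is differentiable (`u ∈ C²`, `W` differentiable). -/
theorem differentiable_energyDensity (hu : ContDiff ℝ 2 u) (hW : Differentiable ℝ W)
    {e : ℝ × ℝ → ℝ}
    (he : ∀ z, e z = (fderiv ℝ u z (1, 0)) ^ 2 + (fderiv ℝ u z (0, 1)) ^ 2 + W z * u z ^ 2) :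
    Differentiable ℝ e := by
  have h1 := differentiable_fderiv_apply hu (1, 0)
  have h2 := differentiable_fderiv_apply hu (0, 1)
  have h3 := differentiable_of_contDiff_two hu
  have : e = fun z => (fderiv ℝ u z (1, 0)) ^ 2 + (fderiv ℝ u z (0, 1)) ^ 2 + W z * u z ^ 2 :=
    funext he
  rw [this]
  exact ((h1.pow 2).add (h2.pow 2)).add (hW.mul (h3.pow 2))

/-- The defect `F = u_tt − u_xx + W u` is continuous (`u ∈ C²`, `W` continuous). -/
theorem continuous_defect (hu : ContDiff ℝ 2 u) (hW : Continuous W) {F : ℝ × ℝ → ℝ}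
    (hF : ∀ z, F z = fderiv ℝ (fderiv ℝ u) z (1, 0) (1, 0)
      - fderiv ℝ (fderiv ℝ u) z (0, 1) (0, 1) + W z * u z) :
    Continuous F := by
  have hc := (hu.fderiv_right (m := 1) (by norm_num)).continuous_fderiv (by norm_num)
  have h1 : Continuous fun z => fderiv ℝ (fderiv ℝ u) z (1, 0) (1, 0) :=
    (hc.clm_apply continuous_const).clm_apply continuous_const
  have h2 : Continuous fun z => fderiv ℝ (fderiv ℝ u) z (0, 1) (0, 1) :=
    (hc.clm_apply continuous_const).clm_apply continuous_const
  have h3 := (differentiable_of_contDiff_two hu).continuous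
  have : F = fun z => fderiv ℝ (fderiv ℝ u) z (1, 0) (1, 0)
      - fderiv ℝ (fderiv ℝ u) z (0, 1) (0, 1) + W z * u z := funext hF
  rw [this]
  exact (h1.sub h2).add (hW.mul h3)

/-- `∂ₜ e` along a `t`-slice with a time-dependent potential:
`2 u_t u_tt + 2 u_x u_xt + W_t u² + 2 W u u_t`. -/
theorem hasDerivAt_energyDensity_slice_fst (hu : ContDiff ℝ 2 u) (hW : Differentiable ℝ W)
    {e : ℝ × ℝ → ℝ}
    (he : ∀ z, e z = (fderiv ℝ u z (1, 0)) ^ 2 + (fderiv ℝ u z (0, 1)) ^ 2 + W z * u z ^ 2)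
    (t x : ℝ) :
    HasDerivAt (fun τ => e (τ, x))
      (2 * fderiv ℝ u (t, x) (1, 0) * fderiv ℝ (fderiv ℝ u) (t, x) (1, 0) (1, 0)
        + 2 * fderiv ℝ u (t, x) (0, 1) * fderiv ℝ (fderiv ℝ u) (t, x) (1, 0) (0, 1)
        + (fderiv ℝ W (t, x) (1, 0) * u (t, x) ^ 2
          + W (t, x) * (2 * u (t, x) * fderiv ℝ u (t, x) (1, 0)))) t := by
  have h1 := hasDerivAt_fderiv_apply_slice_fst hu (1, 0) t x
  have h2 := hasDerivAt_fderiv_apply_slice_fst hu (0, 1) t x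
  have h3 := hasDerivAt_slice_fst (differentiable_of_contDiff_two hu) t x
  have h4 := hasDerivAt_slice_fst hW t x
  have h := ((h1.pow 2).add (h2.pow 2)).add (h4.mul (h3.pow 2))
  have hfun : (fun τ => e (τ, x)) = fun τ =>
      (fderiv ℝ u (τ, x) (1, 0)) ^ 2 + (fderiv ℝ u (τ, x) (0, 1)) ^ 2 + W (τ, x) * u (τ, x) ^ 2 :=
    funext fun τ => he (τ, x)
  rw [hfun]
  refine h.congr_deriv ?_
  simp only [Pi.pow_apply]
  push_cast
  ring

/-- **Local energy law with defect.** For `u ∈ C²`, `W` differentiable,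
`∂ₜ e − ∂ₓ m = 2 u_t F + (∂ₜ W) u²` with `F = u_tt − u_xx + W u` the defect. [folklore] -/
theorem fderiv_energyDensity_sub (hu : ContDiff ℝ 2 u) (hW : Differentiable ℝ W)
    {e m F : ℝ × ℝ → ℝ}
    (he : ∀ z, e z = (fderiv ℝ u z (1, 0)) ^ 2 + (fderiv ℝ u z (0, 1)) ^ 2 + W z * u z ^ 2)
    (hm : ∀ z, m z = 2 * fderiv ℝ u z (1, 0) * fderiv ℝ u z (0, 1))
    (hF : ∀ z, F z = fderiv ℝ (fderiv ℝ u) z (1, 0) (1, 0)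
      - fderiv ℝ (fderiv ℝ u) z (0, 1) (0, 1) + W z * u z) (z : ℝ × ℝ) :
    fderiv ℝ e z (1, 0) - fderiv ℝ m z (0, 1)
      = 2 * fderiv ℝ u z (1, 0) * F z + fderiv ℝ W z (1, 0) * u z ^ 2 := by
  obtain ⟨t, x⟩ := z
  have hE := (hasDerivAt_slice_fst (differentiable_energyDensity hu hW he) t x).unique
    (hasDerivAt_energyDensity_slice_fst hu hW he t x)
  have hM := (hasDerivAt_slice_snd (differentiable_momentumDensity hu hm) t x).unique
    (hasDerivAt_momentumDensity_slice_snd hu hm t x)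
  rw [hE, hM, hF]
  have hsymm := fderiv_fderiv_symm hu (t, x) (1, 0) (0, 1)
  linear_combination (2 * fderiv ℝ u (t, x) (0, 1)) * hsymm

/-! ### The weighted energy identity with affinely moving ends and a source -/

/-- **Weighted energy identity with affinely moving ends, time-dependent potential and defect
source.**  `u ∈ C²(ℝ²)`, `W ∈ C¹(ℝ²)`, `χ ∈ C¹(ℝ)`; `e = u_t² + u_x² + W u²`, `m = 2 u_t u_x`,
`F = u_tt − u_xx + W u`.  For `α(t) = a₀ + a₁ t`, `β(t) = b₀ + b₁ t`:
`∫_{α t₂}^{β t₂} χ e(t₂,·) − ∫_{α t₁}^{β t₁} χ e(t₁,·)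
  = ∫_{t₁}^{t₂} [χ(β t)(m + b₁ e)(t, β t) − χ(α t)(m + a₁ e)(t, α t)] dt
    + ∫_{t₁}^{t₂} ∫_{α t}^{β t} (χ(x)(2 u_t F + W_t u²)(t,x) − χ'(x) m(t,x)) dx dt`
(oriented integrals, no ordering hypotheses). [folklore] -/
theorem weightedEnergy_identity_affine (hu : ContDiff ℝ 2 u) (hW : ContDiff ℝ 1 W)
    {χ : ℝ → ℝ} (hχ : ContDiff ℝ 1 χ)
    {e m F : ℝ × ℝ → ℝ}
    (he : ∀ z, e z = (fderiv ℝ u z (1, 0)) ^ 2 + (fderiv ℝ u z (0, 1)) ^ 2 + W z * u z ^ 2)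
    (hm : ∀ z, m z = 2 * fderiv ℝ u z (1, 0) * fderiv ℝ u z (0, 1))
    (hF : ∀ z, F z = fderiv ℝ (fderiv ℝ u) z (1, 0) (1, 0)
      - fderiv ℝ (fderiv ℝ u) z (0, 1) (0, 1) + W z * u z)
    (a₀ a₁ b₀ b₁ t₁ t₂ : ℝ) :
    (∫ x in (a₀ + a₁ * t₂)..(b₀ + b₁ * t₂), χ x * e (t₂, x))
        - ∫ x in (a₀ + a₁ * t₁)..(b₀ + b₁ * t₁), χ x * e (t₁, x)
      = (∫ t in t₁..t₂, (χ (b₀ + b₁ * t) * (m (t, b₀ + b₁ * t) + b₁ * e (t, b₀ + b₁ * t))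
          - χ (a₀ + a₁ * t) * (m (t, a₀ + a₁ * t) + a₁ * e (t, a₀ + a₁ * t))))
        + ∫ t in t₁..t₂, ∫ x in (a₀ + a₁ * t)..(b₀ + b₁ * t),
            (χ x * (2 * fderiv ℝ u (t, x) (1, 0) * F (t, x) + fderiv ℝ W (t, x) (1, 0) * u (t, x) ^ 2)
              - deriv χ x * m (t, x)) := by
  have hWd : Differentiable ℝ W := hW.differentiable (by norm_num)
  have hWc' : Continuous (fun z => fderiv ℝ W z (1, 0)) :=
    (hW.continuous_fderiv (by norm_num)).clm_apply continuous_const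
  have hχd : Differentiable ℝ χ := hχ.differentiable (by norm_num)
  have hχc' : Continuous (deriv χ) := hχ.continuous_deriv (by norm_num)
  have hed := differentiable_energyDensity hu hWd he
  have hmd := differentiable_momentumDensity hu hm
  have hec := hed.continuous
  have hmc := hmd.continuous
  have hFc := continuous_defect hu hWd.continuous hF
  have hud := differentiable_of_contDiff_two hu
  have hutc := continuous_fderiv_apply hu (1, 0)
  have hcons := fderiv_energyDensity_sub hu hWd he hm hF
  -- the source density
  set S : ℝ × ℝ → ℝ := fun z =>
    χ z.2 * (2 * fderiv ℝ u z (1, 0) * F z + fderiv ℝ W z (1, 0) * u z ^ 2)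
      - deriv χ z.2 * m z with hS
  have hSc : Continuous S := by
    simp only [hS]
    have hχ2 : Continuous fun z : ℝ × ℝ => χ z.2 := hχd.continuous.comp continuous_snd
    have hχ2' : Continuous fun z : ℝ × ℝ => deriv χ z.2 := hχc'.comp continuous_snd
    exact (hχ2.mul (((continuous_const.mul hutc).mul hFc).add (hWc'.mul (hud.continuous.pow 2)))).sub
      (hχ2'.mul hmc)
  -- the pulled-back pair on the box `[t₁, t₂] × [0, 1]`
  set Fb : ℝ × ℝ → ℝ := fun p =>
    (b₀ + b₁ * p.1 - (a₀ + a₁ * p.1))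
      * (χ ((b₀ + b₁ * p.1 - (a₀ + a₁ * p.1)) * p.2 + (a₀ + a₁ * p.1))
        * e (p.1, (b₀ + b₁ * p.1 - (a₀ + a₁ * p.1)) * p.2 + (a₀ + a₁ * p.1))) with hFb
  set Gb : ℝ × ℝ → ℝ := fun p =>
    -(χ ((b₀ + b₁ * p.1 - (a₀ + a₁ * p.1)) * p.2 + (a₀ + a₁ * p.1))
      * (m (p.1, (b₀ + b₁ * p.1 - (a₀ + a₁ * p.1)) * p.2 + (a₀ + a₁ * p.1))
        + (a₁ + (b₁ - a₁) * p.2) * e (p.1, (b₀ + b₁ * p.1 - (a₀ + a₁ * p.1)) * p.2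
          + (a₀ + a₁ * p.1)))) with hGb
  have hFbd : Differentiable ℝ Fb := by
    simp only [hFb]
    fun_prop
  have hGbd : Differentiable ℝ Gb := by
    simp only [hGb]
    fun_prop
  -- divergence of `(Fb, Gb)` is `L(t) · S(t, X(t, θ))`
  have hdiv : ∀ t θ : ℝ, fderiv ℝ Fb (t, θ) (1, 0) + fderiv ℝ Gb (t, θ) (0, 1)
      = (b₀ + b₁ * t - (a₀ + a₁ * t))
        * S (t, (b₀ + b₁ * t - (a₀ + a₁ * t)) * θ + (a₀ + a₁ * t)) := by
    intro t θ
    have haff : ∀ (p q s : ℝ), HasDerivAt (fun τ : ℝ => p + q * τ) q s := fun p q s => by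
      simpa using ((hasDerivAt_id s).const_mul q).const_add p
    have hL : HasDerivAt (fun τ : ℝ => b₀ + b₁ * τ - (a₀ + a₁ * τ)) (b₁ - a₁) t :=
      (haff b₀ b₁ t).fun_sub (haff a₀ a₁ t)
    have hX : HasDerivAt (fun τ : ℝ => (b₀ + b₁ * τ - (a₀ + a₁ * τ)) * θ + (a₀ + a₁ * τ))
        ((b₁ - a₁) * θ + a₁) t :=
      (hL.mul_const θ).fun_add (haff a₀ a₁ t)
    have hγ : HasDerivAt (fun τ : ℝ => (τ, (b₀ + b₁ * τ - (a₀ + a₁ * τ)) * θ + (a₀ + a₁ * τ)))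
        ((1 : ℝ), (b₁ - a₁) * θ + a₁) t := (hasDerivAt_id' t).prodMk hX
    have hY : HasDerivAt (fun θ' : ℝ => (b₀ + b₁ * t - (a₀ + a₁ * t)) * θ' + (a₀ + a₁ * t))
        (b₀ + b₁ * t - (a₀ + a₁ * t)) θ := by
      simpa using ((hasDerivAt_id θ).const_mul (b₀ + b₁ * t - (a₀ + a₁ * t))).add_const
        (a₀ + a₁ * t)
    have hδ : HasDerivAt (fun θ' : ℝ => (t, (b₀ + b₁ * t - (a₀ + a₁ * t)) * θ' + (a₀ + a₁ * t)))
        ((0 : ℝ), (b₀ + b₁ * t - (a₀ + a₁ * t))) θ := (hasDerivAt_const θ t).prodMk hY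
    have hcoef : HasDerivAt (fun θ' : ℝ => a₁ + (b₁ - a₁) * θ') (b₁ - a₁) θ := haff a₁ (b₁ - a₁) θ
    set Xv : ℝ := (b₀ + b₁ * t - (a₀ + a₁ * t)) * θ + (a₀ + a₁ * t) with hXv
    set L : ℝ := b₀ + b₁ * t - (a₀ + a₁ * t) with hLdef
    -- `χ ∘ X` along `t` and along `θ`
    have hχt : HasDerivAt (fun τ : ℝ => χ ((b₀ + b₁ * τ - (a₀ + a₁ * τ)) * θ + (a₀ + a₁ * τ)))
        (deriv χ Xv * ((b₁ - a₁) * θ + a₁)) t := (hχd Xv).hasDerivAt.comp t hX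
    have hχθ : HasDerivAt (fun θ' : ℝ => χ ((b₀ + b₁ * t - (a₀ + a₁ * t)) * θ' + (a₀ + a₁ * t)))
        (deriv χ Xv * L) θ := (hχd Xv).hasDerivAt.comp θ hY
    have hFs : HasDerivAt (fun τ => Fb (τ, θ))
        ((b₁ - a₁) * (χ Xv * e (t, Xv))
          + L * (deriv χ Xv * ((b₁ - a₁) * θ + a₁) * e (t, Xv)
            + χ Xv * fderiv ℝ e (t, Xv) ((1 : ℝ), (b₁ - a₁) * θ + a₁))) t := by
      have h := hL.fun_mul (hχt.fun_mul (hasDerivAt_comp_curve hed hγ))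
      exact h
    have hGs : HasDerivAt (fun θ' => Gb (t, θ'))
        (-(deriv χ Xv * L * (m (t, Xv) + (a₁ + (b₁ - a₁) * θ) * e (t, Xv))
          + χ Xv * (fderiv ℝ m (t, Xv) ((0 : ℝ), L)
            + ((b₁ - a₁) * e (t, Xv)
              + (a₁ + (b₁ - a₁) * θ) * fderiv ℝ e (t, Xv) ((0 : ℝ), L))))) θ := by
      have h := (hχθ.fun_mul ((hasDerivAt_comp_curve hmd hδ).fun_add
        (hcoef.fun_mul (hasDerivAt_comp_curve hed hδ)))).fun_neg
      exact h
    have h1 := (hasDerivAt_slice_fst hFbd t θ).unique hFs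
    have h2 := (hasDerivAt_slice_snd hGbd t θ).unique hGs
    rw [h1, h2, clm_apply_one_snd (fderiv ℝ e (t, Xv)) ((b₁ - a₁) * θ + a₁),
      clm_apply_zero_snd (fderiv ℝ m (t, Xv)) L,
      clm_apply_zero_snd (fderiv ℝ e (t, Xv)) L]
    have hc := hcons (t, Xv)
    simp only [hS]
    linear_combination (L * χ Xv) * hc
  -- Green's formula on the box
  have hdivfun : (fun z : ℝ × ℝ => fderiv ℝ Fb z (1, 0) + fderiv ℝ Gb z (0, 1))
      = fun z => (b₀ + b₁ * z.1 - (a₀ + a₁ * z.1))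
        * S (z.1, (b₀ + b₁ * z.1 - (a₀ + a₁ * z.1)) * z.2 + (a₀ + a₁ * z.1)) :=
    funext fun z => hdiv z.1 z.2
  have hdivc : Continuous (fun z : ℝ × ℝ => fderiv ℝ Fb z (1, 0) + fderiv ℝ Gb z (0, 1)) := by
    rw [hdivfun]
    fun_prop
  have key := integral2_divergence_prod_of_hasFDerivAt Fb Gb (fderiv ℝ Fb) (fderiv ℝ Gb) t₁ 0 t₂ 1
    hFbd.continuous.continuousOn hGbd.continuous.continuousOn
    (fun z _ => (hFbd z).hasFDerivAt) (fun z _ => (hGbd z).hasFDerivAt)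
    (hdivc.continuousOn.integrableOn_compact (isCompact_uIcc.prod isCompact_uIcc))
  -- the left-hand side of Green's formula is the double integral of the source
  have hlhs : (∫ t in t₁..t₂, ∫ θ in (0 : ℝ)..1,
      fderiv ℝ Fb (t, θ) (1, 0) + fderiv ℝ Gb (t, θ) (0, 1))
      = ∫ t in t₁..t₂, ∫ x in (a₀ + a₁ * t)..(b₀ + b₁ * t), S (t, x) := by
    simp_rw [hdiv]
    refine intervalIntegral.integral_congr fun t _ => ?_
    rw [intervalIntegral.integral_const_mul,
      intervalIntegral.mul_integral_comp_mul_add (f := fun x => S (t, x))]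
    congr 1 <;> ring
  rw [hlhs] at key
  -- evaluate the four boundary terms
  have hG1 : ∀ t, Gb (t, 1) = -(χ (b₀ + b₁ * t) * (m (t, b₀ + b₁ * t) + b₁ * e (t, b₀ + b₁ * t))) := by
    intro t
    have h1 : (b₀ + b₁ * t - (a₀ + a₁ * t)) * 1 + (a₀ + a₁ * t) = b₀ + b₁ * t := by ring
    have h2 : a₁ + (b₁ - a₁) * 1 = b₁ := by ring
    simp only [hGb, h1, h2]
  have hG0 : ∀ t, Gb (t, 0) = -(χ (a₀ + a₁ * t) * (m (t, a₀ + a₁ * t) + a₁ * e (t, a₀ + a₁ * t))) := by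
    intro t
    have h1 : (b₀ + b₁ * t - (a₀ + a₁ * t)) * 0 + (a₀ + a₁ * t) = a₀ + a₁ * t := by ring
    have h2 : a₁ + (b₁ - a₁) * 0 = a₁ := by ring
    simp only [hGb, h1, h2]
  have hFint : ∀ t, (∫ θ in (0 : ℝ)..1, Fb (t, θ))
      = ∫ x in (a₀ + a₁ * t)..(b₀ + b₁ * t), χ x * e (t, x) := by
    intro t
    simp only [hFb]
    rw [intervalIntegral.integral_const_mul,
      intervalIntegral.mul_integral_comp_mul_add (f := fun x => χ x * e (t, x))]
    congr 1 <;> ring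
  rw [hFint, hFint] at key
  simp_rw [hG1, hG0] at key
  have hi1 : IntervalIntegrable
      (fun t => -(χ (b₀ + b₁ * t) * (m (t, b₀ + b₁ * t) + b₁ * e (t, b₀ + b₁ * t)))) volume t₁ t₂ := by
    apply Continuous.intervalIntegrable
    have hχc := hχd.continuous
    fun_prop
  have hi0 : IntervalIntegrable
      (fun t => -(χ (a₀ + a₁ * t) * (m (t, a₀ + a₁ * t) + a₁ * e (t, a₀ + a₁ * t)))) volume t₁ t₂ := by
    apply Continuous.intervalIntegrable
    have hχc := hχd.continuous
    fun_prop
  have hsub := intervalIntegral.integral_sub hi0 hi1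
  have hcongr : (∫ t in t₁..t₂, (χ (b₀ + b₁ * t) * (m (t, b₀ + b₁ * t) + b₁ * e (t, b₀ + b₁ * t))
      - χ (a₀ + a₁ * t) * (m (t, a₀ + a₁ * t) + a₁ * e (t, a₀ + a₁ * t))))
      = ∫ t in t₁..t₂, (-(χ (a₀ + a₁ * t) * (m (t, a₀ + a₁ * t) + a₁ * e (t, a₀ + a₁ * t)))
        - -(χ (b₀ + b₁ * t) * (m (t, b₀ + b₁ * t) + b₁ * e (t, b₀ + b₁ * t)))) := by
    congr 1
    funext t
    ring
  have hSrw : (∫ t in t₁..t₂, ∫ x in (a₀ + a₁ * t)..(b₀ + b₁ * t),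
      (χ x * (2 * fderiv ℝ u (t, x) (1, 0) * F (t, x) + fderiv ℝ W (t, x) (1, 0) * u (t, x) ^ 2)
        - deriv χ x * m (t, x)))
      = ∫ t in t₁..t₂, ∫ x in (a₀ + a₁ * t)..(b₀ + b₁ * t), S (t, x) := by
    simp only [hS]
  rw [hcongr, hsub, hSrw]
  linarith

/-- Unweighted specialisation (`χ ≡ 1`): energy identity with affinely moving ends, time-dependent
potential and defect source. [folklore] -/
theorem energy_identity_affine_source (hu : ContDiff ℝ 2 u) (hW : ContDiff ℝ 1 W)
    {e m F : ℝ × ℝ → ℝ}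
    (he : ∀ z, e z = (fderiv ℝ u z (1, 0)) ^ 2 + (fderiv ℝ u z (0, 1)) ^ 2 + W z * u z ^ 2)
    (hm : ∀ z, m z = 2 * fderiv ℝ u z (1, 0) * fderiv ℝ u z (0, 1))
    (hF : ∀ z, F z = fderiv ℝ (fderiv ℝ u) z (1, 0) (1, 0)
      - fderiv ℝ (fderiv ℝ u) z (0, 1) (0, 1) + W z * u z)
    (a₀ a₁ b₀ b₁ t₁ t₂ : ℝ) :
    (∫ x in (a₀ + a₁ * t₂)..(b₀ + b₁ * t₂), e (t₂, x))
        - ∫ x in (a₀ + a₁ * t₁)..(b₀ + b₁ * t₁), e (t₁, x)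
      = (∫ t in t₁..t₂, ((m (t, b₀ + b₁ * t) + b₁ * e (t, b₀ + b₁ * t))
          - (m (t, a₀ + a₁ * t) + a₁ * e (t, a₀ + a₁ * t))))
        + ∫ t in t₁..t₂, ∫ x in (a₀ + a₁ * t)..(b₀ + b₁ * t),
            (2 * fderiv ℝ u (t, x) (1, 0) * F (t, x) + fderiv ℝ W (t, x) (1, 0) * u (t, x) ^ 2) := by
  have key := weightedEnergy_identity_affine hu hW (χ := fun _ => (1 : ℝ)) contDiff_const he hm hF
    a₀ a₁ b₀ b₁ t₁ t₂
  simp only [one_mul, deriv_const', zero_mul, sub_zero] at key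
  exact key

/-- With `W ≥ 0` the energy density dominates the momentum density: `m ≤ e`. -/
theorem momentum_le_energy (hW0 : ∀ z, 0 ≤ W z) {e m : ℝ × ℝ → ℝ}
    (he : ∀ z, e z = (fderiv ℝ u z (1, 0)) ^ 2 + (fderiv ℝ u z (0, 1)) ^ 2 + W z * u z ^ 2)
    (hm : ∀ z, m z = 2 * fderiv ℝ u z (1, 0) * fderiv ℝ u z (0, 1)) (z : ℝ × ℝ) :
    m z ≤ e z := by
  rw [he, hm]
  nlinarith [sq_nonneg (fderiv ℝ u z (1, 0) - fderiv ℝ u z (0, 1)),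
    mul_nonneg (hW0 z) (sq_nonneg (u z))]

/-- With `W ≥ 0`: `−m ≤ e`. -/
theorem neg_momentum_le_energy (hW0 : ∀ z, 0 ≤ W z) {e m : ℝ × ℝ → ℝ}
    (he : ∀ z, e z = (fderiv ℝ u z (1, 0)) ^ 2 + (fderiv ℝ u z (0, 1)) ^ 2 + W z * u z ^ 2)
    (hm : ∀ z, m z = 2 * fderiv ℝ u z (1, 0) * fderiv ℝ u z (0, 1)) (z : ℝ × ℝ) :
    -m z ≤ e z := by
  rw [he, hm]
  nlinarith [sq_nonneg (fderiv ℝ u z (1, 0) + fderiv ℝ u z (0, 1)),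
    mul_nonneg (hW0 z) (sq_nonneg (u z))]

/-- With `W ≥ 0` the energy density is non-negative. -/
theorem energyDensity_nonneg (hW0 : ∀ z, 0 ≤ W z) {e : ℝ × ℝ → ℝ}
    (he : ∀ z, e z = (fderiv ℝ u z (1, 0)) ^ 2 + (fderiv ℝ u z (0, 1)) ^ 2 + W z * u z ^ 2)
    (z : ℝ × ℝ) : 0 ≤ e z := by
  rw [he]
  nlinarith [sq_nonneg (fderiv ℝ u z (1, 0)), sq_nonneg (fderiv ℝ u z (0, 1)),
    mul_nonneg (hW0 z) (sq_nonneg (u z))]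

/-- **Future domain of dependence, local form.**  `u ∈ C²(ℝ²)`, `W ∈ C¹(ℝ²)`, `W ≥ 0`, `t₁ ≤ t₂`.
If the defect `u_tt − u_xx + W u` and `∂ₜW` vanish on the solid backward characteristic trapezoid
`{(t, x) | t₁ ≤ t ≤ t₂, x ∈ [a + (t − t₁), b − (t − t₁)]}` (unordered intervals), then the energy on
the shrunken interval at time `t₂` is at most the energy on `[a, b]` at time `t₁`.  (`u` need only
solve the equation there — this is the form used for cut-off solutions defined on part of the
plane.) [folklore] -/
theorem energy_shrinking_le_of_defect (hu : ContDiff ℝ 2 u) (hW : ContDiff ℝ 1 W)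
    (hW0 : ∀ z, 0 ≤ W z) {e : ℝ × ℝ → ℝ}
    (he : ∀ z, e z = (fderiv ℝ u z (1, 0)) ^ 2 + (fderiv ℝ u z (0, 1)) ^ 2 + W z * u z ^ 2)
    (a b : ℝ) {t₁ t₂ : ℝ} (ht : t₁ ≤ t₂)
    (hsol : ∀ t ∈ Icc t₁ t₂, ∀ x ∈ uIcc (a + (t - t₁)) (b - (t - t₁)),
      fderiv ℝ (fderiv ℝ u) (t, x) (1, 0) (1, 0) - fderiv ℝ (fderiv ℝ u) (t, x) (0, 1) (0, 1)
        + W (t, x) * u (t, x) = 0)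
    (hWt : ∀ t ∈ Icc t₁ t₂, ∀ x ∈ uIcc (a + (t - t₁)) (b - (t - t₁)),
      fderiv ℝ W (t, x) (1, 0) = 0) :
    (∫ x in (a + (t₂ - t₁))..(b - (t₂ - t₁)), e (t₂, x)) ≤ ∫ x in a..b, e (t₁, x) := by
  set m : ℝ × ℝ → ℝ := fun z => 2 * fderiv ℝ u z (1, 0) * fderiv ℝ u z (0, 1) with hmdef
  have hm : ∀ z, m z = 2 * fderiv ℝ u z (1, 0) * fderiv ℝ u z (0, 1) := fun z => rfl
  set F : ℝ × ℝ → ℝ := fun z => fderiv ℝ (fderiv ℝ u) z (1, 0) (1, 0)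
      - fderiv ℝ (fderiv ℝ u) z (0, 1) (0, 1) + W z * u z with hFdef
  have hF : ∀ z, F z = fderiv ℝ (fderiv ℝ u) z (1, 0) (1, 0)
      - fderiv ℝ (fderiv ℝ u) z (0, 1) (0, 1) + W z * u z := fun z => rfl
  have key := energy_identity_affine_source hu hW he hm hF (a - t₁) 1 (b + t₁) (-1) t₁ t₂
  have e1 : a - t₁ + 1 * t₂ = a + (t₂ - t₁) := by ring
  have e2 : b + t₁ + -1 * t₂ = b - (t₂ - t₁) := by ring
  have e3 : a - t₁ + 1 * t₁ = a := by ring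
  have e4 : b + t₁ + -1 * t₁ = b := by ring
  rw [e1, e2, e3, e4] at key
  -- the source vanishes on the trapezoid
  have hsrc : (∫ t in t₁..t₂, ∫ x in (a - t₁ + 1 * t)..(b + t₁ + -1 * t),
      (2 * fderiv ℝ u (t, x) (1, 0) * F (t, x) + fderiv ℝ W (t, x) (1, 0) * u (t, x) ^ 2)) = 0 := by
    refine (intervalIntegral.integral_congr (g := fun _ => (0 : ℝ)) fun t hts => ?_).trans (by simp)
    have htI : t ∈ Icc t₁ t₂ := by rwa [uIcc_of_le ht] at hts
    refine (intervalIntegral.integral_congr (g := fun _ => (0 : ℝ)) fun x hx => ?_).trans (by simp)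
    have hx' : x ∈ uIcc (a + (t - t₁)) (b - (t - t₁)) := by
      have e5 : a - t₁ + 1 * t = a + (t - t₁) := by ring
      have e6 : b + t₁ + -1 * t = b - (t - t₁) := by ring
      rwa [e5, e6] at hx
    simp only [hF, hsol t htI x hx', hWt t htI x hx', mul_zero, zero_mul, add_zero]
  rw [hsrc, add_zero] at key
  have hle : (∫ t in t₁..t₂,
      ((m (t, b + t₁ + -1 * t) + -1 * e (t, b + t₁ + -1 * t))
        - (m (t, a - t₁ + 1 * t) + 1 * e (t, a - t₁ + 1 * t)))) ≤ 0 := by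
    have h : 0 ≤ ∫ t in t₁..t₂,
      -(((m (t, b + t₁ + -1 * t) + -1 * e (t, b + t₁ + -1 * t))
        - (m (t, a - t₁ + 1 * t) + 1 * e (t, a - t₁ + 1 * t)))) :=
      intervalIntegral.integral_nonneg ht (fun t _ => by
        have h1 := momentum_le_energy hW0 he hm (t, b + t₁ + -1 * t)
        have h2 := neg_momentum_le_energy hW0 he hm (t, a - t₁ + 1 * t)
        linarith)
    rw [intervalIntegral.integral_neg] at h
    linarith
  linarith

end WaveDefect

end

end Summit.FinalStateConjecture.FinalStateConjecture.Theorems
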